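/-
Copyright: public-audit package `pub-balaban` (b2b-balaban), seat pv16-g19. Released under Apache 2.0 like Mathlib.
-/
import Literature.MathematicalPhysics.QuantumFieldTheory.Balaban1983to89.T4WilsonDisjointLinks
import Literature.MathematicalPhysics.QuantumFieldTheory.Balaban1983to89.T4CondMeanChannelInsert
import Literature.MathematicalPhysics.QuantumFieldTheory.Balaban1983to89.T4SeparableFibreExpansion

/-!
# `Balaban1983to89.T4WilsonResponseJunction` — the CONSUMER-SIDE JUNCTION of the gnomonic-window Wilson plug
# (`T4WilsonDisjointLinks.mem_respDom_of_wilson_disjoint`, lineage pv28) into the (CM) channel in the (β) currency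
# (`T4CovarianceResponse.meanLipschitz_of_varianceBound`, `T4CondMeanChannelInsert.condMean_channel_of_varianceBound`,
# lineage pv16): for the `k = 0` `SU(2)` Wilson Gibbs law windowed gnomonically about a reference field `u₀` on a
# PLAQUETTE-DISJOINT link set `s`, the conditional means of bounded chart-`C¹` inserts are LIPSCHITZ IN THE EXTERIOR on
# the STAPLE LIVE SET `{u | ε + Σ_{b ∈ s} stapleDist b u₀ u ≤ 1/8}` with an EXPLICIT modulus, and the (CM) channel bound
# (I6) holds there — every response-side hypothesis of route (R) discharged BY NAME, the remaining binders listed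
# (cell T4, node O3b; row `T4-O3.E-i′-β-CONVRESP-WILSON*`, Q24(a) self-row of lineage pv16 generation 19)
# — v1.1 [append-only]: + §6 the inversion symmetry of the windowed Wilson conditional law at the FLAT exterior and
# `MeanVanishes` for bondwise inversion-odd inserts, §7 the channel about the flat field with NO law-side hypothesis

HONEST FRAMING.  Audit cell `pub-balaban`, unit `b2b-balaban-pv16-g19` (SURGE NODE PROVER #16; companion record
`HOME/t4/T4-EST-O3Ei1.md` §4l).  The cell's T4 target is the existence and uniqueness of the continuum limit of
unit-scale averaged loop expectations on a FINITE torus, with Bałaban's densities as GIVEN data satisfying the printed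
end statement (B) as a HYPOTHESIS; it is NOT an infinite-volume statement, NOT a mass gap, NOT the Clay problem, and
this module is NOT progress on any summit.  Value = kernel-checked bookkeeping and nothing more: it JOINS two chains
already in the tree and proves no new estimate.  Route (R) of the (CM) channel (`T4CovarianceResponse`: the
conditional mean of a bond insert responds to the exterior at the rate `σ·τ·dev`, `σ`, `τ` the Brascamp–Lieb response
moduli of the exponent gap and of the insert, packaged as the RESPONSE DOMAIN `respDom`) was, until now, inhabited by
nothing but its reference exterior (`self_mem_respDom`).  The pv28 lineage discharged the response domain for the
`k = 0` Wilson exponent `h = −β·A_w` and the product gnomonic window `χ_{s,u₀,S}` (`T4CubeChartTransport` →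
`T4CubeConvexExtension` → `T4GnomonicWilsonHessian` → `T4WilsonDatumBounds` → `T4WilsonSmallFieldNumerics` →
`T4WilsonStapleDeviation` → `T4WilsonDisjointLinks`), ending in `mem_respDom_of_wilson_disjoint`: an exterior `u`
lies in `respDom s χ_{s,u₀,S} (−β·A_w) u₀ B T (Σ_{b∈s} stapleDist b u₀ ·) (β·w·(1+ρ+ρ²)/√λ) (L/√λ)`,
`λ = gnoKappa S′ + 7/25·(β·w·2(d−1))`, from the window numbers, the reference small field `reTr(u₀(∂p)) ≥ 1 − ε`
through `s`, the budget `ε + Σ_b stapleDist b u₀ u ≤ 1/8`, the chart-`C¹` bound `L` of the inserts, and four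
`u`-INDEPENDENT binders (measurability of the exponent, a bound `hC` on the Gibbs factor, an oscillation bound `hK` of
the exponent on the fibre, a chart enumeration `e`).  THIS MODULE (i) discharges the four `u`-independent binders for
the Wilson exponent on ANY regular gauge group (`|−β·A_w| ≤ |β|·#plaquettes·2|w|`, §1) and the consumer's proviso
`hne` (positive window mass, `T4CubeChartGnomonic.fibreIntegral_windowDensity_mul_exp_ne_zero`), (ii) ADOPTS pv28's
`Σ_b stapleDist b u₀` as the consumer deviation functional (the hand-off (USE) of `T4WilsonStapleDeviation`), names the
STAPLE LIVE SET `stapleLive s u₀ ε` and proves `stapleLive s u₀ ε ⊆ respDom …` (§2), (iii) feeds it to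
`meanLipschitz_of_varianceBound` ∕ `condMeanSuppression_of_varianceBound` ∕ `condMean_channel_of_varianceBound` BY
NAME (§3–§4), and (iv) records the one-link case `s = {b}` and the FLAT reference `u₀ = 1`, `ε = 0`, where no field
hypothesis at all is left (§5).  What REMAINS a binder after this module, honestly: the reference small field `hsf₀`
(for `u₀ ≠ 1`), the window numbers `0 < S < S′ ≤ 1`, `0 ≤ ρ ≤ 1/4`, `3·S′² ≤ ρ²`, the insert data (measurable,
bounded by `R`, chart-`C¹` with gradient bound `L` on the window cube), the (α)-node datum `MeanVanishes` at `u₀`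
(row O3.E-i′ (α)∕K — NOT touched), and — the substantive located item — that the live set of the consumer's ACTUAL
term lies inside `stapleLive s u₀ ε` UNIFORMLY in the step index (an estimate on Bałaban's small-field conditions,
NOT claimed; for `k ≥ 1` the exponent is not the bare Wilson action and nothing here applies verbatim).

CITATION HEADER.  Nothing of T. Bałaban's series (CMP 1984–89) is newly read, quoted or attributed in this module.  The
only contact with print is CONTEXT through tree headers quoted EARLIER and not re-quoted here: the Wilson action
`wilsonAction w` is the tree's model of [Balaban1987RG1] (0.2) p. 252 (`Setup`), the window∕small-field structure is
that located by the pv28 record (B12 (0.18)-type conditions — located, not asserted), and the term structure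
(`condLaw`, `condMean`, `fibreIntegral`, `liveSet`, `linDensity`, `fibreReading`, `MeanLipschitz`,
`CondMeanSuppression`, `MeanVanishes`, `respDom`) is the cell's typed model of one term of [Balaban1989LargeFieldI]
(0.3) as documented in `B15BasicStep` ∕ `T4DressingDefect` ∕ `T4CondMeanChannel` ∕ `T4FirstOrderSize` ∕
`T4CovarianceResponse`.  ABSOLUTE RULE honoured: no programme-internal statement is an input; every declaration below
is [folklore] bookkeeping (finite sums, `abs`, measurability of finite sums of continuous functions of coordinates,
set inclusions, specialisation of theorems already in the tree).

NEW vs PRINTED-TYPE.  PRINTED-TYPE: none newly used.  CELL MODEL typed EARLIER (by name): the plug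
`T4WilsonDisjointLinks.mem_respDom_of_wilson_disjoint` (+ `PlaqDisjoint`, `plaqDisjoint_singleton`), the staple
deviation `T4WilsonStapleDeviation.stapleDist`, the window `T4CubeChartGnomonic.windowDensity` (+ its measurability,
`[0,1]`-valuedness, positive mass), the response side `T4CovarianceResponse.respDom` ∕ `meanLipschitz_of_varianceBound`
∕ `condMeanSuppression_of_varianceBound`, the channel `T4CondMeanChannelInsert.condMean_channel_of_varianceBound`.
NEW HERE (kernel, [folklore]): §1 the Wilson exponent bounds, §2 `stapleLive` and the inclusion, §3–§5 the junction
theorems and their one-link ∕ flat-reference instances.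
[v1.1, APPEND-ONLY — one import (`T4SeparableFibreExpansion`, for `bondReflect` ∕ `map_bondReflect_condLaw`), §6–§7
and these header lines added; nothing of v1 changed.]  CELL MODEL typed EARLIER used additionally in §6 (by name):
`T4SeparableFibreExpansion.bondReflect` ∕ `bondReflectEquiv` ∕ `map_bondReflect_condLaw` (Haar inversion and
translation invariance of the fibre law), `T4WilsonDisjointLinks.mul_wilsonAction_updateFinset` (the exponent is
multi-affine link by link on a plaquette-disjoint fibre), `T4WilsonLinkAffine.wilsonDatum_one` ∕ `su2Quat_inv` (the
datum at the flat field is REAL; `q(g⁻¹) = star q(g)`), `T4CubeChartGnomonic.gnoWindow_one` ∕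
`windowDensity_updateFinset` and `T4WilsonGaugeFlatDirection.gnoPoint_neg` (the gnomonic window about `1` is
inversion-symmetric).  NEW in v1.1 (kernel, [folklore]): §6 the inversion symmetry of the windowed Wilson conditional
law at the flat exterior and `MeanVanishes` for bondwise inversion-odd inserts; §7 (J2)∕(J3) about the flat field with
no law-side hypothesis.

WHAT IS PROVED (all [folklore]; no `sorry`, no new axiom):
§1 (any `[GaugeGroup G] [MeasurableSpace G] [RegularGaugeGroup G]`) `abs_one_sub_reTr_le_two`, `abs_wilsonAction_le`
   (`|A_w(U)| ≤ #Plaq·(|w|·2)`), `wilsonBound P j β w = |β|·(#Plaq·(|w|·2))`, `abs_neg_mul_wilsonAction_le`,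
   `abs_wilsonGap_le` (the plug's `hK` with `K = 2·wilsonBound`), `measurable_wilsonAction`,
   `measurable_neg_mul_wilsonAction` (the plug's `hhm`); for `SU2` and the gnomonic window: `wilsonGibbs_le` (the
   plug's and the consumer's `hC` with `C = e^{wilsonBound}`), `fibreIntegral_wilsonGibbs_ne_zero` (the consumer's
   `hne` at EVERY exterior), `respLam`, `respSlope` (names for `λ` and `β·w·(1+ρ+ρ²)/√λ`; `respLam_ge`: `λ ≥ 960/289`
   under the window numbers, so the moduli are not junk values), `respSlope_nonneg`.
§2 `stapleLive s u₀ ε = {u | ε + Σ_{b : s} stapleDist b u₀ u ≤ 1/8}`; `self_mem_stapleLive` (`u₀ ∈` iff-direction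
   `ε ≤ 1/8`), `stapleLive_antitone` (in `ε`), `sum_stapleDist_le_of_mem` (`Σ ≤ 1/8 − ε` on it),
   `stapleLive_subset_respDom` (THE JUNCTION LEMMA: `⊆ respDom s χ_{s,u₀,S} (−β·A_w) u₀ B T (Σ stapleDist) respSlope
   (L/√respLam)` from `PlaqDisjoint s`, the window numbers, `0 ≤ β`, `0 ≤ w`, `0 ≤ ε`, `hsf₀`, insert data `hBm`∕`hBg`
   along any chart enumeration `e : s × Fin 3 ≃ Fin n`).
§3 `meanLipschitz_wilson_disjoint`: `MeanLipschitz (stapleLive s u₀ ε) (u ↦ i ↦ ∫ B y i ∂condLaw s W u) T u₀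
   (Σ stapleDist) (respSlope·(L/√respLam))`, `W = χ_{s,u₀,S}·e^{−β A_w}` — additionally from `0 ≤ L` and a uniform
   bound `R` of the inserts on `T`; `condMeanSuppression_wilson_disjoint` (+ `hflat : MeanVanishes T (∫ B y · ∂condLaw s
   W u₀)`).
§4 `condMean_channel_wilson_disjoint` ((I6) on the staple live set with the cap `d = 1/8 − ε`:
   `|E^{W}_s[linDensity t T a (fibreReading s B) | V_out]| ≤ |t|·(|T|·A·(respSlope·(L/√respLam)·(1/8 − ε)))` for every
   `V ∈ stapleLive s u₀ ε`).
§5 Instances: `sum_stapleDist_singleton`, `stapleLive_singleton` (one link: `{u | ε + stapleDist b u₀ u ≤ 1/8}`),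
   `meanLipschitz_wilson_oneLink` (`s = {b}`, `dev = stapleDist b u₀`, hypotheses on the plaquettes through `b` only);
   `smallField_flat` (`reTr(1(∂p)) = 1 ≥ 1 − 0`), `meanLipschitz_wilson_disjoint_flat` (reference `u₀ = 1`, `ε = 0`:
   NO field hypothesis — window numbers and insert data only), and two non-vacuity `example`s (the reference exterior
   lies in its own staple live set; the canonical enumeration `bondCoordEquiv s` instantiates `e`).
§6 [v1.1] `inv_mem_gnoWindow_one(_iff)` (`g ∈ gnoWindow 1 S ↔ g⁻¹ ∈ gnoWindow 1 S`), `bondReflect_one_apply_self`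
   (`bondReflect 1 b y b = (y b)⁻¹`), `windowDensity_one_bondReflect`, `neg_mul_wilsonAction_one_bondReflect`
   (`PlaqDisjoint s`: `−β·A_w(1[s ← y])` is invariant under `y_b ↦ y_b⁻¹`), `wilsonGibbs_one_bondReflect`,
   `map_bondReflect_condLaw_wilson_flat` (`(condLaw s W 1).map (bondReflect 1 b) = condLaw s W 1` for every `b ∈ s`,
   `W = χ_{s,1,S}·e^{−β A_w}`), `integral_eq_zero_of_odd_bondReflect`, `meanVanishes_wilson_flat` (`MeanVanishes T
   (i ↦ ∫ B y i ∂condLaw s W 1)` whenever every `B · i`, `i ∈ T`, is odd under `bondReflect 1 b` for some `b : s`),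
   and a non-vacuity `example` (the transverse quaternion coordinate `(su2Quat (y b)).imI` is such an insert).
§7 [v1.1] `condMeanSuppression_wilson_disjoint_flat`, `condMean_channel_wilson_disjoint_flat`: (J2)∕(J3) about
   `u₀ = 1`, `ε = 0` for bondwise inversion-odd inserts — hypotheses `PlaqDisjoint s`, the window numbers, `0 ≤ β`,
   `0 ≤ w`, the insert data and the coefficient bound ONLY; the channel bound reads
   `|E^{W}_s[linDensity t T a (fibreReading s B) | V_out]| ≤ |t|·(|T|·A·(respSlope·(L/√respLam)·(1/8)))` for every `V`
   with `Σ_{b∈s} stapleDist b 1 V ≤ 1/8`.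

HONEST SCOPE.  (a) `k = 0`, `G = SU(2)`, bare Wilson exponent, PLAQUETTE-DISJOINT `s` only (pv28 caveats (N1-gen),
(w): star-free sets with shared plaquettes untouched, star-containing sets have no `β`-gain).  (b) The deviation is the
SUM over `s` and the budget `ε + Σ ≤ 1/8` is linear in `|s|` (pv28 caveat (SIZE-Σ)).  (c) `MeanVanishes` at `u₀` is a
binder (the (α) datum); at the flat reference with inversion-odd inserts it is a symmetry statement about `condLaw s W
1` NOT proved here.  (d) The consumer's real live set is `liveSet s W′` of ITS term `W′`; that it sits inside
`stapleLive s u₀ ε` for Bałaban's windows, uniformly in `k`, is the located estimate (EST) and is NOT claimed.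
(e) Nothing printed is asserted; value = kernel certificate, NOT summit progress.
(c′) [v1.1] The symmetry statement of (c) IS now proved (§6) — for PLAQUETTE-DISJOINT `s`, the reference `u₀ = 1` and
inserts odd under the inversion of one fibre variable (§7 then has no law-side hypothesis); for `u₀ ≠ 1`, for inserts
with no odd bond, or for `s` with shared plaquettes (where `Re tr(a·b·c⁻¹) ≠ Re tr(b·a·c⁻¹)` breaks the symmetry)
`MeanVanishes` stays a binder, and (a), (b), (d), (e) stand unchanged.
-/

noncomputable section

open _root_.MeasureTheory
open Function (updateFinset)
open scoped BigOperators

namespace Literature.MathematicalPhysics.QuantumFieldTheory.Balaban1983to89.T4WilsonResponseJunction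

open B15.BasicStep T4DressingDefect T4FirstOrderSize
open T4TiltModulus (fibreBase)
open T4CubePoincare (cube)
open T4CubeChartGnomonic (SU2 gnoFibreChart windowDensity bondCoordEquiv measurable_windowDensity windowDensity_nonneg
  windowDensity_le_one windowDensity_mul_exp_le fibreIntegral_windowDensity_mul_exp_ne_zero)
open T4CubeConvexExtension (gnoKappa)
open T4WilsonLinkAffine (IsLetter)
open T4WilsonSmallFieldNumerics (gnoKappa_window_ge)
open T4WilsonStapleDeviation (stapleDist stapleDist_nonneg stapleDist_self)
open T4WilsonDisjointLinks (PlaqDisjoint plaqDisjoint_singleton mem_respDom_of_wilson_disjoint)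
open T4CovarianceResponse (respDom meanLipschitz_of_varianceBound condMeanSuppression_of_varianceBound)
open T4CondMeanChannel (linDensity fibreReading)
open T4CondMeanChannelInsert (condMean_channel_of_varianceBound)
open Literature.Probability.Distributions (coordGradient)

/-! ## §1  The Wilson exponent: bounds, measurability, the Gibbs factor of the gnomonic window -/

section Exponent

variable {P : Params} {j : ℕ} {G : Type*} [GaugeGroup G] [MeasurableSpace G] [RegularGaugeGroup G]

/-- `|1 − Re tr g| ≤ 2` (the plaquette density takes values in `[0, 2]`). [folklore] -/
theorem abs_one_sub_reTr_le_two (g : G) : |1 - reTr g| ≤ 2 := by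
  have h := RegularGaugeGroup.one_sub_reTr_mem_Icc g
  rw [abs_le]
  constructor <;> linarith [h.1, h.2]

/-- `|A_w(U)| ≤ #plaquettes · (|w|·2)`. [folklore] -/
theorem abs_wilsonAction_le (w : ℝ) (U : GaugeField P j G) :
    |wilsonAction w U| ≤ Fintype.card (Plaq P j) * (|w| * 2) := by
  unfold wilsonAction
  calc |∑ p : Plaq P j, w * (1 - reTr (GaugeField.plaqHol U p))|
      ≤ ∑ p : Plaq P j, |w * (1 - reTr (GaugeField.plaqHol U p))| := Finset.abs_sum_le_sum_abs _ _
    _ ≤ ∑ _p : Plaq P j, |w| * 2 := Finset.sum_le_sum fun p _ => by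
        rw [abs_mul]
        exact mul_le_mul_of_nonneg_left (abs_one_sub_reTr_le_two _) (abs_nonneg w)
    _ = Fintype.card (Plaq P j) * (|w| * 2) := by
        rw [Finset.sum_const, Finset.card_univ, nsmul_eq_mul]

/-- THE WILSON EXPONENT BOUND `|β|·(#plaquettes·(|w|·2))`. [folklore] -/
def wilsonBound (P : Params) (j : ℕ) (β w : ℝ) : ℝ := |β| * (Fintype.card (Plaq P j) * (|w| * 2))

omit [MeasurableSpace G] [RegularGaugeGroup G] in
/-- The Wilson exponent bound is non-negative. [folklore] -/
theorem wilsonBound_nonneg (β w : ℝ) : 0 ≤ wilsonBound P j β w := by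
  unfold wilsonBound
  positivity

/-- `|−β·A_w(U)| ≤ wilsonBound`. [folklore] -/
theorem abs_neg_mul_wilsonAction_le (β w : ℝ) (U : GaugeField P j G) :
    |-β * wilsonAction w U| ≤ wilsonBound P j β w := by
  rw [wilsonBound, abs_mul, abs_neg]
  exact mul_le_mul_of_nonneg_left (abs_wilsonAction_le w U) (abs_nonneg β)

/-- The oscillation of the Wilson exponent between ANY two fields is `≤ 2·wilsonBound` (the plug's binder `hK`,
uniformly in the exterior). [folklore] -/
theorem abs_wilsonGap_le (β w : ℝ) (U V : GaugeField P j G) :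
    |(-β * wilsonAction w U) - (-β * wilsonAction w V)| ≤ 2 * wilsonBound P j β w :=
  (abs_sub _ _).trans (by linarith [abs_neg_mul_wilsonAction_le β w U, abs_neg_mul_wilsonAction_le (P := P) β w V])

/-- The Wilson action `A_w` is measurable (plaquette variables by `Missing.measurable_plaqHol`). [folklore] -/
theorem measurable_wilsonAction (w : ℝ) : Measurable fun U : GaugeField P j G => wilsonAction w U := by
  unfold wilsonAction
  refine Finset.measurable_sum _ fun p _ => ?_
  exact measurable_const.mul
    (measurable_const.sub (RegularGaugeGroup.measurable_reTr.comp (Missing.measurable_plaqHol p)))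

/-- The Wilson exponent `−β·A_w` is measurable (the plug's binder `hhm`). [folklore] -/
theorem measurable_neg_mul_wilsonAction (β w : ℝ) : Measurable fun U : GaugeField P j G => -β * wilsonAction w U :=
  measurable_const.mul (measurable_wilsonAction w)

end Exponent

section Gibbs

variable {P : Params} {j : ℕ} {s : Finset (PBond P j)} {u₀ : GaugeField P j SU2} {S : ℝ}

/-- The windowed Wilson Gibbs factor is `≤ e^{wilsonBound}` (the binder `hC` of the plug and of the consumers).
[folklore] -/
theorem wilsonGibbs_le (β w : ℝ) (U : GaugeField P j SU2) :
    windowDensity s u₀ S U * Real.exp (-β * wilsonAction w U) ≤ Real.exp (wilsonBound P j β w) :=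
  windowDensity_mul_exp_le (h := fun U => -β * wilsonAction w U) (abs_neg_mul_wilsonAction_le β w) U

variable [DecidableEq (PBond P j)]

/-- The windowed Wilson Gibbs law has POSITIVE window mass at the reference exterior, `S > 0` (the consumer's proviso
`hne`). [folklore] -/
theorem fibreIntegral_wilsonGibbs_ne_zero (hS : 0 < S) (β w : ℝ) :
    fibreIntegral s (fun U => windowDensity s u₀ S U * Real.exp (-β * wilsonAction w U)) u₀ ≠ 0 :=
  fibreIntegral_windowDensity_mul_exp_ne_zero hS (abs_neg_mul_wilsonAction_le β w)

end Gibbs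

section Moduli

/-- THE RESPONSE MODULUS `λ = gnoKappa S′ + 7/25·(β·w·2(d−1))` of the pv28 plug (Jacobian half + action half).
[folklore] -/
abbrev respLam (P : Params) (β w S' : ℝ) : ℝ := gnoKappa S' + 7 / 25 * (β * w * (2 * ((P.d : ℝ) - 1)))

/-- THE GAP SLOPE `β·w·(1+ρ+ρ²)/√λ` of the pv28 plug. [folklore] -/
abbrev respSlope (P : Params) (β w ρ S' : ℝ) : ℝ := β * w * (1 + ρ + ρ ^ 2) / Real.sqrt (respLam P β w S')

/-- Under the window numbers (`3·S′² ≤ ρ² ≤ 1/16`) and `0 ≤ β·w`, `d ≥ 1`: `λ ≥ 960/289 > 0` — the moduli below are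
not junk values of `Real.sqrt` ∕ division. [folklore] -/
theorem respLam_ge {P : Params} {β w ρ S' : ℝ} (hβ : 0 ≤ β) (hw : 0 ≤ w) (hρ : 0 ≤ ρ) (hρ4 : ρ ≤ 1 / 4)
    (h3S : 3 * S' ^ 2 ≤ ρ ^ 2) (hd : 1 ≤ P.d) : 960 / 289 ≤ respLam P β w S' := by
  have hρ2 : ρ ^ 2 ≤ 1 / 16 := by nlinarith
  have hk := gnoKappa_window_ge (h3S.trans hρ2)
  have hd' : (1 : ℝ) ≤ P.d := by exact_mod_cast hd
  have : 0 ≤ 7 / 25 * (β * w * (2 * ((P.d : ℝ) - 1))) := by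
    have : 0 ≤ (P.d : ℝ) - 1 := by linarith
    positivity
  unfold respLam
  linarith

/-- The gap slope is non-negative for `0 ≤ β`, `0 ≤ w`, `0 ≤ ρ`. [folklore] -/
theorem respSlope_nonneg {P : Params} {β w ρ S' : ℝ} (hβ : 0 ≤ β) (hw : 0 ≤ w) (hρ : 0 ≤ ρ) :
    0 ≤ respSlope P β w ρ S' :=
  div_nonneg (by positivity) (Real.sqrt_nonneg _)

end Moduli

/-! ## §2  The staple live set and the junction lemma -/

section Live

variable {P : Params} {j : ℕ} [DecidableEq (PBond P j)]

/-- **THE STAPLE LIVE SET** of exteriors about the reference `u₀` with small-field slack `ε`: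
`{u | ε + Σ_{b ∈ s} stapleDist b u₀ u ≤ 1/8}` — the field input of `mem_respDom_of_wilson_disjoint` as a set.
[folklore] -/
def stapleLive (s : Finset (PBond P j)) (u₀ : GaugeField P j SU2) (ε : ℝ) : Set (GaugeField P j SU2) :=
  {u | ε + ∑ b : ↥s, stapleDist (b : PBond P j) u₀ u ≤ 1 / 8}

variable {s : Finset (PBond P j)} {u₀ : GaugeField P j SU2} {ε : ℝ}

/-- Membership, unfolded. [folklore] -/
theorem mem_stapleLive {u : GaugeField P j SU2} :
    u ∈ stapleLive s u₀ ε ↔ ε + ∑ b : ↥s, stapleDist (b : PBond P j) u₀ u ≤ 1 / 8 := Iff.rfl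

/-- Non-vacuity: the reference exterior lies in its own staple live set iff `ε ≤ 1/8`. [folklore] -/
theorem self_mem_stapleLive : u₀ ∈ stapleLive s u₀ ε ↔ ε ≤ 1 / 8 := by
  simp only [mem_stapleLive, stapleDist_self, Finset.sum_const_zero, add_zero]

/-- The staple live set shrinks as the slack `ε` grows. [folklore] -/
theorem stapleLive_antitone {ε' : ℝ} (h : ε' ≤ ε) : stapleLive s u₀ ε ⊆ stapleLive s u₀ ε' := by
  intro u hu
  rw [mem_stapleLive] at hu ⊢
  linarith

/-- On the staple live set the deviation is capped by `1/8 − ε` (the channel's `hdev`). [folklore] -/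
theorem sum_stapleDist_le_of_mem {u : GaugeField P j SU2} (hu : u ∈ stapleLive s u₀ ε) :
    ∑ b : ↥s, stapleDist (b : PBond P j) u₀ u ≤ 1 / 8 - ε := by
  rw [mem_stapleLive] at hu
  linarith

variable {n : ℕ} {S : ℝ}

/-- **THE JUNCTION LEMMA.**  For a plaquette-disjoint `s`, the window numbers, `0 ≤ β`, `0 ≤ w`, `0 ≤ ε`, the
reference small field `reTr(u₀(∂p)) ≥ 1 − ε` on the plaquettes through `s`, and measurable chart-`C¹` inserts with
gradient bound `L` on the window cube: the staple live set lies inside the RESPONSE DOMAIN of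
`T4CovarianceResponse` for the windowed Wilson Gibbs law, the deviation `Σ_b stapleDist b u₀`, the slope `respSlope`
and the insert modulus `L/√respLam` — `mem_respDom_of_wilson_disjoint` with its `u`-independent binders discharged by
§1. [folklore] -/
theorem stapleLive_subset_respDom {ι : Type*} (hdis : PlaqDisjoint s) (e : ↥s × Fin 3 ≃ Fin n) (hS : 0 < S)
    {S' : ℝ} (hSS' : S < S') (hS'1 : S' ≤ 1) {β w : ℝ} (hβ : 0 ≤ β) (hw : 0 ≤ w) (hε0 : 0 ≤ ε)
    (hsf₀ : ∀ b ∈ s, ∀ p, IsLetter b p → 1 - ε ≤ reTr (GaugeField.plaqHol u₀ p))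
    {ρ : ℝ} (hρ : 0 ≤ ρ) (hρ4 : ρ ≤ 1 / 4) (h3S : 3 * S' ^ 2 ≤ ρ ^ 2)
    {B : (↥s → SU2) → ι → ℝ} {T : Finset ι} (hBm : ∀ i ∈ T, Measurable fun y => B y i) {L : ℝ}
    (hBg : ∀ i ∈ T, ∃ g : (Fin n → ℝ) → ℝ, ContDiff ℝ 1 g ∧
      (∀ x ∈ cube n S, g x = B (gnoFibreChart s u₀ e x) i) ∧
      ∀ x ∈ cube n S, coordGradient g x ⬝ᵥ coordGradient g x ≤ L ^ 2) :
    stapleLive s u₀ ε ⊆ respDom s (windowDensity s u₀ S) (fun U => -β * wilsonAction w U) u₀ B T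
      (fun U => ∑ b : ↥s, stapleDist (b : PBond P j) u₀ U) (respSlope P β w ρ S')
      (L / Real.sqrt (respLam P β w S')) := by
  intro u hu
  exact mem_respDom_of_wilson_disjoint (u₀ := u₀) (u := u) hdis e hS hSS' hS'1 hβ hw
    (measurable_neg_mul_wilsonAction β w) (wilsonGibbs_le β w) (fun y => abs_wilsonGap_le β w _ _) hε0
    (mem_stapleLive.1 hu) hsf₀ hρ hρ4 h3S hBm hBg

end Live

/-! ## §3  `MeanLipschitz` ∕ `CondMeanSuppression` of the Wilson conditional means on the staple live set -/

section Junction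

variable {P : Params} {j : ℕ} [DecidableEq (PBond P j)]
variable {s : Finset (PBond P j)} {u₀ : GaugeField P j SU2} {ε : ℝ} {n : ℕ} {S : ℝ}

/-- **(J1) `MeanLipschitz` OF THE WILSON CONDITIONAL MEANS.**  Same data as `stapleLive_subset_respDom` plus `0 ≤ L`
and a uniform bound `R` of the inserts on `T`: the exterior-indexed conditional means
`u ↦ (i ↦ ∫ B y i ∂condLaw s (χ_{s,u₀,S}·e^{−β A_w}) u)` satisfy pv16's `T4FirstOrderSize.MeanLipschitz` on
`stapleLive s u₀ ε` relative to `u₀`, deviation `Σ_b stapleDist b u₀`, modulus `respSlope·(L/√respLam)` —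
`T4CovarianceResponse.meanLipschitz_of_varianceBound` BY NAME on the sub-domain. [folklore] -/
theorem meanLipschitz_wilson_disjoint {ι : Type*} (hdis : PlaqDisjoint s) (e : ↥s × Fin 3 ≃ Fin n) (hS : 0 < S)
    {S' : ℝ} (hSS' : S < S') (hS'1 : S' ≤ 1) {β w : ℝ} (hβ : 0 ≤ β) (hw : 0 ≤ w) (hε0 : 0 ≤ ε)
    (hsf₀ : ∀ b ∈ s, ∀ p, IsLetter b p → 1 - ε ≤ reTr (GaugeField.plaqHol u₀ p))
    {ρ : ℝ} (hρ : 0 ≤ ρ) (hρ4 : ρ ≤ 1 / 4) (h3S : 3 * S' ^ 2 ≤ ρ ^ 2)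
    {B : (↥s → SU2) → ι → ℝ} {T : Finset ι} (hBm : ∀ i ∈ T, Measurable fun y => B y i) {L : ℝ} (hL : 0 ≤ L)
    (hBg : ∀ i ∈ T, ∃ g : (Fin n → ℝ) → ℝ, ContDiff ℝ 1 g ∧
      (∀ x ∈ cube n S, g x = B (gnoFibreChart s u₀ e x) i) ∧
      ∀ x ∈ cube n S, coordGradient g x ⬝ᵥ coordGradient g x ≤ L ^ 2)
    {R : ℝ} (hR : ∀ i ∈ T, ∀ y, ‖B y i‖ ≤ R) :
    MeanLipschitz (stapleLive s u₀ ε)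
      (fun u i => ∫ y, B y i ∂condLaw s (fun U => windowDensity s u₀ S U * Real.exp (-β * wilsonAction w U)) u)
      T u₀ (fun U => ∑ b : ↥s, stapleDist (b : PBond P j) u₀ U)
      (respSlope P β w ρ S' * (L / Real.sqrt (respLam P β w S'))) := by
  intro u hu
  exact meanLipschitz_of_varianceBound (E := ℝ) s (measurable_windowDensity s u₀ S)
    (measurable_neg_mul_wilsonAction β w) (fun U => windowDensity_nonneg U) (wilsonGibbs_le β w)
    (fibreIntegral_wilsonGibbs_ne_zero hS β w) (fun i hi => (hBm i hi).aestronglyMeasurable) hR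
    (respSlope_nonneg hβ hw hρ) (div_nonneg hL (Real.sqrt_nonneg _)) u
    (stapleLive_subset_respDom hdis e hS hSS' hS'1 hβ hw hε0 hsf₀ hρ hρ4 h3S hBm hBg hu)

/-- **(J2) `CondMeanSuppression`** of the same conditional means on the staple live set, given the (α)-node datum
`MeanVanishes` at the reference exterior (row O3.E-i′ (α)∕K — a binder, NOT touched here) —
`T4CovarianceResponse.condMeanSuppression_of_varianceBound` BY NAME on the sub-domain. [folklore] -/
theorem condMeanSuppression_wilson_disjoint {ι : Type*} (hdis : PlaqDisjoint s) (e : ↥s × Fin 3 ≃ Fin n)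
    (hS : 0 < S) {S' : ℝ} (hSS' : S < S') (hS'1 : S' ≤ 1) {β w : ℝ} (hβ : 0 ≤ β) (hw : 0 ≤ w) (hε0 : 0 ≤ ε)
    (hsf₀ : ∀ b ∈ s, ∀ p, IsLetter b p → 1 - ε ≤ reTr (GaugeField.plaqHol u₀ p))
    {ρ : ℝ} (hρ : 0 ≤ ρ) (hρ4 : ρ ≤ 1 / 4) (h3S : 3 * S' ^ 2 ≤ ρ ^ 2)
    {B : (↥s → SU2) → ι → ℝ} {T : Finset ι} (hBm : ∀ i ∈ T, Measurable fun y => B y i) {L : ℝ} (hL : 0 ≤ L)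
    (hBg : ∀ i ∈ T, ∃ g : (Fin n → ℝ) → ℝ, ContDiff ℝ 1 g ∧
      (∀ x ∈ cube n S, g x = B (gnoFibreChart s u₀ e x) i) ∧
      ∀ x ∈ cube n S, coordGradient g x ⬝ᵥ coordGradient g x ≤ L ^ 2)
    {R : ℝ} (hR : ∀ i ∈ T, ∀ y, ‖B y i‖ ≤ R)
    (hflat : MeanVanishes T fun i =>
      ∫ y, B y i ∂condLaw s (fun U => windowDensity s u₀ S U * Real.exp (-β * wilsonAction w U)) u₀) :
    CondMeanSuppression (stapleLive s u₀ ε)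
      (fun u i => ∫ y, B y i ∂condLaw s (fun U => windowDensity s u₀ S U * Real.exp (-β * wilsonAction w U)) u)
      T (fun U => ∑ b : ↥s, stapleDist (b : PBond P j) u₀ U)
      (respSlope P β w ρ S' * (L / Real.sqrt (respLam P β w S'))) :=
  condMeanSuppression_of_flat
    (hL := meanLipschitz_wilson_disjoint hdis e hS hSS' hS'1 hβ hw hε0 hsf₀ hρ hρ4 h3S hBm hL hBg hR) hflat

/-! ## §4  The (CM) channel (I6) on the staple live set -/

/-- **(J3) THE (CM) CHANNEL IN THE (β) CURRENCY FOR THE WINDOWED WILSON LAW.**  Same data as (J2): for every exterior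
`V` in the staple live set, `|E^{W}_s[linDensity t T a (fibreReading s B) | V_out]| ≤
|t|·(|T|·A·(respSlope·(L/√respLam)·(1/8 − ε)))`, `W = χ_{s,u₀,S}·e^{−β A_w}` —
`T4CondMeanChannelInsert.condMean_channel_of_varianceBound` BY NAME with `L := stapleLive s u₀ ε`, `d := 1/8 − ε`.
No exponential of any oscillation, no ceiling; the insert law's live set being inside `stapleLive` is the consumer's
(EST) input, NOT claimed. [folklore] -/
theorem condMean_channel_wilson_disjoint {ι : Type*} (hdis : PlaqDisjoint s) (e : ↥s × Fin 3 ≃ Fin n) (hS : 0 < S)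
    {S' : ℝ} (hSS' : S < S') (hS'1 : S' ≤ 1) {β w : ℝ} (hβ : 0 ≤ β) (hw : 0 ≤ w) (hε0 : 0 ≤ ε)
    (hsf₀ : ∀ b ∈ s, ∀ p, IsLetter b p → 1 - ε ≤ reTr (GaugeField.plaqHol u₀ p))
    {ρ : ℝ} (hρ : 0 ≤ ρ) (hρ4 : ρ ≤ 1 / 4) (h3S : 3 * S' ^ 2 ≤ ρ ^ 2)
    {B : (↥s → SU2) → ι → ℝ} {T : Finset ι} (hBm : ∀ i ∈ T, Measurable fun y => B y i) {L : ℝ} (hL : 0 ≤ L)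
    (hBg : ∀ i ∈ T, ∃ g : (Fin n → ℝ) → ℝ, ContDiff ℝ 1 g ∧
      (∀ x ∈ cube n S, g x = B (gnoFibreChart s u₀ e x) i) ∧
      ∀ x ∈ cube n S, coordGradient g x ⬝ᵥ coordGradient g x ≤ L ^ 2)
    {R : ℝ} (hR : ∀ i ∈ T, ∀ y, ‖B y i‖ ≤ R)
    (hflat : MeanVanishes T fun i =>
      ∫ y, B y i ∂condLaw s (fun U => windowDensity s u₀ S U * Real.exp (-β * wilsonAction w U)) u₀)
    (t : ℝ) {a : ι → ℝ} {A : ℝ} (hA : ∀ i ∈ T, ‖a i‖ ≤ A) :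
    ∀ V ∈ stapleLive s u₀ ε,
      |condMean s (fun U => windowDensity s u₀ S U * Real.exp (-β * wilsonAction w U))
          (linDensity t T a (fibreReading s B)) V|
        ≤ |t| * ((T.card : ℝ) * A * (respSlope P β w ρ S' * (L / Real.sqrt (respLam P β w S')) * (1 / 8 - ε))) :=
  condMean_channel_of_varianceBound (E := ℝ) s (measurable_windowDensity s u₀ S) (measurable_neg_mul_wilsonAction β w)
    (fun U => windowDensity_nonneg U) (wilsonGibbs_le β w) (fibreIntegral_wilsonGibbs_ne_zero hS β w)
    (fun i hi => (hBm i hi).stronglyMeasurable) hR (respSlope_nonneg hβ hw hρ) (div_nonneg hL (Real.sqrt_nonneg _))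
    hflat (stapleLive_subset_respDom hdis e hS hSS' hS'1 hβ hw hε0 hsf₀ hρ hρ4 h3S hBm hBg)
    (fun _ hV => sum_stapleDist_le_of_mem hV) t hA

end Junction

/-! ## §5  Instances: one link; the flat reference -/

section Instances

variable {P : Params} {j : ℕ} [DecidableEq (PBond P j)]
variable {u₀ : GaugeField P j SU2} {ε : ℝ} {n : ℕ} {S : ℝ}

/-- On the one-link fibre the summed deviation is the staple deviation of the link. [folklore] -/
@[simp] theorem sum_stapleDist_singleton (b : PBond P j) (u₀ u : GaugeField P j SU2) :
    ∑ b' : ↥({b} : Finset (PBond P j)), stapleDist (b' : PBond P j) u₀ u = stapleDist b u₀ u := by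
  rw [Finset.sum_coe_sort ({b} : Finset (PBond P j)) (fun b' => stapleDist b' u₀ u), Finset.sum_singleton]

/-- The one-link staple live set is `{u | ε + stapleDist b u₀ u ≤ 1/8}` — the field input of
`T4WilsonStapleDeviation.mem_respDom_of_wilson_stapleDist`. [folklore] -/
theorem stapleLive_singleton (b : PBond P j) (u₀ : GaugeField P j SU2) (ε : ℝ) :
    stapleLive {b} u₀ ε = {u | ε + stapleDist b u₀ u ≤ 1 / 8} := by
  ext u
  rw [mem_stapleLive, sum_stapleDist_singleton, Set.mem_setOf_eq]

/-- **(J1, ONE LINK).**  `s = {b}` (plaquette-disjoint by `plaqDisjoint_singleton`): `MeanLipschitz` on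
`{u | ε + stapleDist b u₀ u ≤ 1/8}` with deviation `stapleDist b u₀` and the SAME modulus, the small-field hypothesis on
the plaquettes through `b` only. [folklore] -/
theorem meanLipschitz_wilson_oneLink {ι : Type*} (b : PBond P j) (e : ↥({b} : Finset (PBond P j)) × Fin 3 ≃ Fin n)
    (hS : 0 < S) {S' : ℝ} (hSS' : S < S') (hS'1 : S' ≤ 1) {β w : ℝ} (hβ : 0 ≤ β) (hw : 0 ≤ w) (hε0 : 0 ≤ ε)
    (hsf₀ : ∀ p, IsLetter b p → 1 - ε ≤ reTr (GaugeField.plaqHol u₀ p))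
    {ρ : ℝ} (hρ : 0 ≤ ρ) (hρ4 : ρ ≤ 1 / 4) (h3S : 3 * S' ^ 2 ≤ ρ ^ 2)
    {B : (↥({b} : Finset (PBond P j)) → SU2) → ι → ℝ} {T : Finset ι} (hBm : ∀ i ∈ T, Measurable fun y => B y i)
    {L : ℝ} (hL : 0 ≤ L)
    (hBg : ∀ i ∈ T, ∃ g : (Fin n → ℝ) → ℝ, ContDiff ℝ 1 g ∧
      (∀ x ∈ cube n S, g x = B (gnoFibreChart {b} u₀ e x) i) ∧
      ∀ x ∈ cube n S, coordGradient g x ⬝ᵥ coordGradient g x ≤ L ^ 2)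
    {R : ℝ} (hR : ∀ i ∈ T, ∀ y, ‖B y i‖ ≤ R) :
    MeanLipschitz {u | ε + stapleDist b u₀ u ≤ 1 / 8}
      (fun u i => ∫ y, B y i ∂condLaw {b} (fun U => windowDensity {b} u₀ S U * Real.exp (-β * wilsonAction w U)) u)
      T u₀ (fun U => stapleDist b u₀ U) (respSlope P β w ρ S' * (L / Real.sqrt (respLam P β w S'))) := by
  have h := meanLipschitz_wilson_disjoint (plaqDisjoint_singleton b) e hS hSS' hS'1 hβ hw hε0
    (fun b' hb' p hp => hsf₀ p (by rwa [Finset.mem_singleton.1 hb'] at hp)) hρ hρ4 h3S hBm hL hBg hR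
  rw [stapleLive_singleton] at h
  intro u hu i hi
  simpa only [sum_stapleDist_singleton] using h u hu i hi

omit [DecidableEq (PBond P j)] in
/-- THE FLAT FIELD IS SMALL: `reTr(1(∂p)) = 1 ≥ 1 − 0` for every plaquette (so `hsf₀` holds at `u₀ = 1`, `ε = 0`, for
every `s`). [folklore] -/
theorem smallField_flat (s : Finset (PBond P j)) :
    ∀ b ∈ s, ∀ p, IsLetter b p → 1 - (0 : ℝ) ≤ reTr (GaugeField.plaqHol (1 : GaugeField P j SU2) p) := by
  intro b _ p _
  change 1 - (0 : ℝ) ≤ reTr ((1 : SU2) * 1 * 1⁻¹ * 1⁻¹)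
  simp [GaugeGroup.reTr_one]

/-- **(J1, FLAT REFERENCE): NO FIELD HYPOTHESIS LEFT.**  About the flat field `u₀ = 1` with slack `ε = 0`, on every
plaquette-disjoint `s`: the conditional means of the windowed Wilson law are `MeanLipschitz` on
`{u | Σ_{b ∈ s} stapleDist b 1 u ≤ 1/8}` with modulus `respSlope·(L/√respLam)` — from the window numbers, `0 ≤ β`,
`0 ≤ w` and the insert data ONLY. [folklore] -/
theorem meanLipschitz_wilson_disjoint_flat {ι : Type*} {s : Finset (PBond P j)} (hdis : PlaqDisjoint s)
    (e : ↥s × Fin 3 ≃ Fin n) (hS : 0 < S) {S' : ℝ} (hSS' : S < S') (hS'1 : S' ≤ 1) {β w : ℝ} (hβ : 0 ≤ β)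
    (hw : 0 ≤ w) {ρ : ℝ} (hρ : 0 ≤ ρ) (hρ4 : ρ ≤ 1 / 4) (h3S : 3 * S' ^ 2 ≤ ρ ^ 2)
    {B : (↥s → SU2) → ι → ℝ} {T : Finset ι} (hBm : ∀ i ∈ T, Measurable fun y => B y i) {L : ℝ} (hL : 0 ≤ L)
    (hBg : ∀ i ∈ T, ∃ g : (Fin n → ℝ) → ℝ, ContDiff ℝ 1 g ∧
      (∀ x ∈ cube n S, g x = B (gnoFibreChart s (1 : GaugeField P j SU2) e x) i) ∧
      ∀ x ∈ cube n S, coordGradient g x ⬝ᵥ coordGradient g x ≤ L ^ 2)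
    {R : ℝ} (hR : ∀ i ∈ T, ∀ y, ‖B y i‖ ≤ R) :
    MeanLipschitz (stapleLive s (1 : GaugeField P j SU2) 0)
      (fun u i => ∫ y, B y i ∂condLaw s
        (fun U => windowDensity s (1 : GaugeField P j SU2) S U * Real.exp (-β * wilsonAction w U)) u)
      T 1 (fun U => ∑ b : ↥s, stapleDist (b : PBond P j) 1 U)
      (respSlope P β w ρ S' * (L / Real.sqrt (respLam P β w S'))) :=
  meanLipschitz_wilson_disjoint hdis e hS hSS' hS'1 hβ hw le_rfl (smallField_flat s) hρ hρ4 h3S hBm hL hBg hR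

/-- Non-vacuity: the reference exterior is in its own staple live set for every slack `ε ≤ 1/8` (there the modulus
multiplies `Σ_b stapleDist b u₀ u₀ = 0`). [folklore] -/
example {s : Finset (PBond P j)} (hε : ε ≤ 1 / 8) : u₀ ∈ stapleLive s u₀ ε := self_mem_stapleLive.2 hε

/-- Non-vacuity of the chart enumeration: the canonical `bondCoordEquiv s : s × Fin 3 ≃ Fin (3|s|)` of
`T4CubeChartGnomonic` instantiates `e` (so (J1)–(J3) are statements about the inserts' `C¹` representatives in the
canonical gnomonic fibre chart). [folklore] -/
example (s : Finset (PBond P j)) : ↥s × Fin 3 ≃ Fin (s.card * 3) := bondCoordEquiv s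

end Instances

open Literature.MathematicalPhysics.QuantumLattice (su2Quat)
open T4HaarSU2Translate (su2Quat_one)
open T4CubePoincare (mem_cube_iff)
open T4CubeChartGnomonic (gnoPoint gnoWindow gnoWindow_one windowDensity_updateFinset)
open T4WilsonLinkAffine (su2Quat_inv wilsonDatum_one)
open T4WilsonGaugeFlatDirection (gnoPoint_neg)
open T4WilsonDisjointLinks (mul_wilsonAction_updateFinset)
open T4SeparableFibreExpansion (bondReflect bondReflectEquiv coe_bondReflectEquiv bondReflect_apply_self
  bondReflect_apply_ne map_bondReflect_condLaw)

/-! ## §6  [v1.1, append-only]  The flat reference: inversion symmetry of the windowed Wilson conditional law in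
every bond of a plaquette-disjoint `s`; `MeanVanishes` for bondwise inversion-odd inserts DISCHARGED -/

section FlatSymmetry

variable {P : Params} {j : ℕ} {S : ℝ}

/-- The gnomonic window about `1` is INVERSION-SYMMETRIC (`P(1,v)⁻¹ = P(1,−v)`, `gnoPoint_neg`, and the cube is
symmetric). [folklore] -/
theorem inv_mem_gnoWindow_one {g : SU2} (hg : g ∈ gnoWindow 1 S) : g⁻¹ ∈ gnoWindow 1 S := by
  rw [gnoWindow_one] at hg ⊢
  obtain ⟨v, hv, rfl⟩ := hg
  refine ⟨-v, ?_, gnoPoint_neg v⟩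
  rw [mem_cube_iff] at hv ⊢
  intro i
  rw [Pi.neg_apply, abs_neg]
  exact hv i

/-- [folklore] -/
theorem inv_mem_gnoWindow_one_iff {g : SU2} : g⁻¹ ∈ gnoWindow 1 S ↔ g ∈ gnoWindow 1 S :=
  ⟨fun h => by simpa only [inv_inv] using inv_mem_gnoWindow_one h, inv_mem_gnoWindow_one⟩

variable [DecidableEq (PBond P j)] {s : Finset (PBond P j)}

/-- THE FLAT BOND REFLECTION of `T4SeparableFibreExpansion` (centre `1`) inverts one fibre variable:
`bondReflect 1 b y = y[b ← y_b⁻¹]`. [folklore] -/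
theorem bondReflect_one_apply_self (b : ↥s) (y : ↥s → SU2) : bondReflect 1 b y b = (y b)⁻¹ := by
  rw [bondReflect_apply_self, Pi.one_apply, one_mul, mul_one]

/-- The product gnomonic window about the FLAT field is invariant under the flat bond reflection on the fibre through
`1`. [folklore] -/
theorem windowDensity_one_bondReflect (b : ↥s) (y : ↥s → SU2) :
    windowDensity s 1 S (updateFinset (1 : GaugeField P j SU2) s (bondReflect 1 b y))
      = windowDensity s 1 S (updateFinset (1 : GaugeField P j SU2) s y) := by
  rw [windowDensity_updateFinset, windowDensity_updateFinset]
  have h1 : ∀ b' : ↥s, (1 : GaugeField P j SU2) (b' : PBond P j) = 1 := fun _ => rfl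
  have hmem : bondReflect 1 b y ∈ Set.pi Set.univ (fun b' : ↥s => gnoWindow ((1 : GaugeField P j SU2) b') S) ↔
      y ∈ Set.pi Set.univ (fun b' : ↥s => gnoWindow ((1 : GaugeField P j SU2) b') S) := by
    simp only [Set.mem_univ_pi, h1]
    constructor
    · intro h b'
      by_cases hb : b' = b
      · subst hb
        have h' := h b'
        rwa [bondReflect_one_apply_self, inv_mem_gnoWindow_one_iff] at h'
      · have h' := h b'
        rwa [bondReflect_apply_ne _ _ _ hb] at h'
    · intro h b'
      by_cases hb : b' = b
      · subst hb
        rw [bondReflect_one_apply_self, inv_mem_gnoWindow_one_iff]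
        exact h b'
      · rw [bondReflect_apply_ne _ _ _ hb]
        exact h b'
  by_cases hy : y ∈ Set.pi Set.univ (fun b' : ↥s => gnoWindow ((1 : GaugeField P j SU2) b') S)
  · rw [Set.indicator_of_mem hy, Set.indicator_of_mem (hmem.2 hy)]
  · rw [Set.indicator_of_notMem hy, Set.indicator_of_notMem (mt hmem.1 hy)]

/-- On a PLAQUETTE-DISJOINT fibre the Wilson exponent about the FLAT field is invariant under the flat bond
reflection: by the multi-affine expansion `mul_wilsonAction_updateFinset` at `u = 1` the `b`-term is
`Re((q(y_b) − 1)·D_b)` with the REAL datum `D_b = wilsonDatum (−β) w 1 b` (`wilsonDatum_one`), and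
`Re(q(y_b⁻¹)) = Re(star q(y_b)) = Re(q(y_b))`. [folklore] -/
theorem neg_mul_wilsonAction_one_bondReflect (hdis : PlaqDisjoint s) (β w : ℝ) (b : ↥s) (y : ↥s → SU2) :
    -β * wilsonAction w (updateFinset (1 : GaugeField P j SU2) s (bondReflect 1 b y))
      = -β * wilsonAction w (updateFinset (1 : GaugeField P j SU2) s y) := by
  rw [mul_wilsonAction_updateFinset hdis (-β) w, mul_wilsonAction_updateFinset hdis (-β) w]
  congr 1
  refine Finset.sum_congr rfl fun b' _ => ?_
  by_cases hb : b' = b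
  · subst hb
    have h1 : (1 : GaugeField P j SU2) (b' : PBond P j) = 1 := rfl
    rw [bondReflect_one_apply_self, h1, wilsonDatum_one, su2Quat_inv, su2Quat_one]
    simp only [Quaternion.re_mul, Quaternion.re_sub, Quaternion.re_star, Quaternion.re_coe, Quaternion.imI_coe,
      Quaternion.imJ_coe, Quaternion.imK_coe, mul_zero, sub_zero]
  · rw [bondReflect_apply_ne _ _ _ hb]

/-- … hence the windowed Wilson Gibbs factor on the fibre through the flat field is reflection-invariant in every bond
of `s`. [folklore] -/
theorem wilsonGibbs_one_bondReflect (hdis : PlaqDisjoint s) (β w : ℝ) (b : ↥s) (y : ↥s → SU2) :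
    windowDensity s 1 S (updateFinset (1 : GaugeField P j SU2) s (bondReflect 1 b y)) *
        Real.exp (-β * wilsonAction w (updateFinset (1 : GaugeField P j SU2) s (bondReflect 1 b y)))
      = windowDensity s 1 S (updateFinset (1 : GaugeField P j SU2) s y) *
        Real.exp (-β * wilsonAction w (updateFinset (1 : GaugeField P j SU2) s y)) := by
  rw [windowDensity_one_bondReflect, neg_mul_wilsonAction_one_bondReflect hdis]

/-- **THE CONDITIONAL LAW OF THE WINDOWED WILSON LAW AT THE FLAT EXTERIOR IS INVERSION-SYMMETRIC IN EVERY BOND** of a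
plaquette-disjoint `s` — `T4SeparableFibreExpansion.map_bondReflect_condLaw` BY NAME (Haar inversion ∕ translation
invariance + the density symmetry above). [folklore] -/
theorem map_bondReflect_condLaw_wilson_flat (hdis : PlaqDisjoint s) (β w : ℝ) (b : ↥s) :
    (condLaw s (fun U => windowDensity s 1 S U * Real.exp (-β * wilsonAction w U)) (1 : GaugeField P j SU2)).map
        (bondReflect 1 b)
      = condLaw s (fun U => windowDensity s 1 S U * Real.exp (-β * wilsonAction w U)) 1 :=
  map_bondReflect_condLaw s _ 1 1 b fun y => wilsonGibbs_one_bondReflect hdis β w b y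

/-- A function ODD under a measure-preserving involution integrates to zero (no integrability needed: both sides of
`integral_map_equiv` are junk `0` together). [folklore] -/
theorem integral_eq_zero_of_odd_bondReflect {μ : Measure (↥s → SU2)} (b : ↥s) (hμ : μ.map (bondReflect 1 b) = μ)
    {f : (↥s → SU2) → ℝ} (hodd : ∀ y, f (bondReflect 1 b y) = -f y) : ∫ y, f y ∂μ = 0 := by
  have h := integral_map_equiv (μ := μ) (bondReflectEquiv 1 b) f
  rw [coe_bondReflectEquiv, hμ] at h
  simp only [hodd, integral_neg] at h
  linarith

/-- **(J4) `MeanVanishes` AT THE FLAT REFERENCE, DISCHARGED**: for the windowed Wilson law about the flat field on a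
plaquette-disjoint `s`, every insert that is ODD under the inversion of SOME fibre variable has conditional mean zero at
the flat exterior — the (α) datum of (J2)∕(J3) for `u₀ = 1`. [folklore] -/
theorem meanVanishes_wilson_flat {ι : Type*} (hdis : PlaqDisjoint s) (β w : ℝ) {B : (↥s → SU2) → ι → ℝ}
    {T : Finset ι} (hodd : ∀ i ∈ T, ∃ b : ↥s, ∀ y, B (bondReflect 1 b y) i = -B y i) :
    MeanVanishes T fun i =>
      ∫ y, B y i ∂condLaw s (fun U => windowDensity s 1 S U * Real.exp (-β * wilsonAction w U))
        (1 : GaugeField P j SU2) := by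
  intro i hi
  obtain ⟨b, hb⟩ := hodd i hi
  exact integral_eq_zero_of_odd_bondReflect b (map_bondReflect_condLaw_wilson_flat hdis β w b) hb

/-- Non-vacuity of `hodd`: the transverse quaternion coordinates of a link variable (`imI`, `imJ`, `imK` of
`su2Quat (y b)`) are odd under the inversion of that variable (`su2Quat g⁻¹ = star (su2Quat g)`). [folklore] -/
example (b : ↥s) : ∀ y : ↥s → SU2, (su2Quat (bondReflect 1 b y b)).imI = -(su2Quat (y b)).imI := fun y => by
  rw [bondReflect_one_apply_self, su2Quat_inv, Quaternion.imI_star]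

end FlatSymmetry

/-! ## §7  [v1.1, append-only]  (J2)∕(J3) about the flat field for bondwise inversion-odd inserts: NO law-side
hypothesis left -/

section FlatChannel

variable {P : Params} {j : ℕ} [DecidableEq (PBond P j)] {n : ℕ} {S : ℝ}

/-- **(J2, FLAT REFERENCE, ODD INSERTS): `CondMeanSuppression` WITH NO LAW-SIDE HYPOTHESIS.**  About the flat field on
a plaquette-disjoint `s`, for inserts each odd under the inversion of some fibre variable: `CondMeanSuppression` on
`stapleLive s 1 0 = {u | Σ_{b∈s} stapleDist b 1 u ≤ 1/8}` with modulus `respSlope·(L/√respLam)` — from the window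
numbers, `0 ≤ β`, `0 ≤ w` and the insert data ONLY ((J2) with `hsf₀ := smallField_flat`, `hflat :=
meanVanishes_wilson_flat`). [folklore] -/
theorem condMeanSuppression_wilson_disjoint_flat {ι : Type*} {s : Finset (PBond P j)} (hdis : PlaqDisjoint s)
    (e : ↥s × Fin 3 ≃ Fin n) (hS : 0 < S) {S' : ℝ} (hSS' : S < S') (hS'1 : S' ≤ 1) {β w : ℝ} (hβ : 0 ≤ β)
    (hw : 0 ≤ w) {ρ : ℝ} (hρ : 0 ≤ ρ) (hρ4 : ρ ≤ 1 / 4) (h3S : 3 * S' ^ 2 ≤ ρ ^ 2)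
    {B : (↥s → SU2) → ι → ℝ} {T : Finset ι} (hBm : ∀ i ∈ T, Measurable fun y => B y i) {L : ℝ} (hL : 0 ≤ L)
    (hBg : ∀ i ∈ T, ∃ g : (Fin n → ℝ) → ℝ, ContDiff ℝ 1 g ∧
      (∀ x ∈ cube n S, g x = B (gnoFibreChart s (1 : GaugeField P j SU2) e x) i) ∧
      ∀ x ∈ cube n S, coordGradient g x ⬝ᵥ coordGradient g x ≤ L ^ 2)
    {R : ℝ} (hR : ∀ i ∈ T, ∀ y, ‖B y i‖ ≤ R)
    (hodd : ∀ i ∈ T, ∃ b : ↥s, ∀ y, B (bondReflect 1 b y) i = -B y i) :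
    CondMeanSuppression (stapleLive s (1 : GaugeField P j SU2) 0)
      (fun u i => ∫ y, B y i ∂condLaw s
        (fun U => windowDensity s (1 : GaugeField P j SU2) S U * Real.exp (-β * wilsonAction w U)) u)
      T (fun U => ∑ b : ↥s, stapleDist (b : PBond P j) 1 U)
      (respSlope P β w ρ S' * (L / Real.sqrt (respLam P β w S'))) :=
  condMeanSuppression_wilson_disjoint hdis e hS hSS' hS'1 hβ hw le_rfl (smallField_flat s) hρ hρ4 h3S hBm hL hBg hR
    (meanVanishes_wilson_flat hdis β w hodd)

/-- **(J3, FLAT REFERENCE, ODD INSERTS): THE (CM) CHANNEL (I6) WITH NO LAW-SIDE HYPOTHESIS.**  For every exterior `V`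
with `Σ_{b∈s} stapleDist b 1 V ≤ 1/8`:
`|E^{W}_s[linDensity t T a (fibreReading s B) | V_out]| ≤ |t|·(|T|·A·(respSlope·(L/√respLam)·(1/8)))`,
`W = χ_{s,1,S}·e^{−β A_w}` — hypotheses: `PlaqDisjoint s`, the window numbers, `0 ≤ β`, `0 ≤ w`, the insert data
(measurable, bounded, chart-`C¹`, bondwise inversion-odd on `T`) and the coefficient bound `A`; NOTHING about the law.
The consumer's (EST) input (its live set inside `stapleLive s 1 0`) is NOT claimed. [folklore] -/
theorem condMean_channel_wilson_disjoint_flat {ι : Type*} {s : Finset (PBond P j)} (hdis : PlaqDisjoint s)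
    (e : ↥s × Fin 3 ≃ Fin n) (hS : 0 < S) {S' : ℝ} (hSS' : S < S') (hS'1 : S' ≤ 1) {β w : ℝ} (hβ : 0 ≤ β)
    (hw : 0 ≤ w) {ρ : ℝ} (hρ : 0 ≤ ρ) (hρ4 : ρ ≤ 1 / 4) (h3S : 3 * S' ^ 2 ≤ ρ ^ 2)
    {B : (↥s → SU2) → ι → ℝ} {T : Finset ι} (hBm : ∀ i ∈ T, Measurable fun y => B y i) {L : ℝ} (hL : 0 ≤ L)
    (hBg : ∀ i ∈ T, ∃ g : (Fin n → ℝ) → ℝ, ContDiff ℝ 1 g ∧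
      (∀ x ∈ cube n S, g x = B (gnoFibreChart s (1 : GaugeField P j SU2) e x) i) ∧
      ∀ x ∈ cube n S, coordGradient g x ⬝ᵥ coordGradient g x ≤ L ^ 2)
    {R : ℝ} (hR : ∀ i ∈ T, ∀ y, ‖B y i‖ ≤ R)
    (hodd : ∀ i ∈ T, ∃ b : ↥s, ∀ y, B (bondReflect 1 b y) i = -B y i)
    (t : ℝ) {a : ι → ℝ} {A : ℝ} (hA : ∀ i ∈ T, ‖a i‖ ≤ A) :
    ∀ V ∈ stapleLive s (1 : GaugeField P j SU2) 0,
      |condMean s (fun U => windowDensity s (1 : GaugeField P j SU2) S U * Real.exp (-β * wilsonAction w U))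
          (linDensity t T a (fibreReading s B)) V|
        ≤ |t| * ((T.card : ℝ) * A * (respSlope P β w ρ S' * (L / Real.sqrt (respLam P β w S')) * (1 / 8))) := by
  intro V hV
  have h := condMean_channel_wilson_disjoint hdis e hS hSS' hS'1 hβ hw le_rfl (smallField_flat s) hρ hρ4 h3S hBm hL
    hBg hR (meanVanishes_wilson_flat hdis β w hodd) t hA V hV
  simpa only [sub_zero] using h

end FlatChannel

end Literature.MathematicalPhysics.QuantumFieldTheory.Balaban1983to89.T4WilsonResponseJunction

end
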